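import Literature.Probability.LatticeModels.PlaneRotatorLiebRivasseauProof
import Literature.Probability.LatticeModels.PlaneRotatorStarTwoPoint
import Literature.Probability.LatticeModels.BesselIRatioBounds
import HarnessLib

/-!
# Lieb's Theorem 4 for plane rotators with the Bessel ratio: the layered XY model decays above Lieb's temperature
# `4u(J∥/T) + 2u(J⊥/T) = 1`, `u = I₁/I₀`

E. H. Lieb, *A refinement of Simon's correlation inequality*, Comm. Math. Phys. **77** (1980) 127–135 [Lieb1980],
Theorem 4 (p. 134): "For the plane rotor model on a ν-dimensional hypercubic lattice there is exponential fall-off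
of the two-point function if `⟨σ_a·σ_b⟩ < 1/2ν` for the two-spin system consisting of `a` and `b` alone. This is
equivalent to `I₁(β)/I₀(β) < 1/2ν`." Inputs (all tree theorems): the separating inequality (23) with the star of
`a` as inside system (`PlaneRotator.twoPoint_le_pow_of_star_rowSum_le`, unconditional since
`PlaneRotator.liebRivasseauInequality_holds`) and the star two-point function
`⟨cos(θ_x − θ_b)⟩_{star(x)} = I₁(K)/I₀(K)` (`twoPoint_starCoupling_eq`, `PlaneRotatorStarTwoPoint.lean`).

* `twoPoint_le_pow_of_besselRatio_rowSum_le` — **Lieb's criterion, general finite-volume form**: `J ≥ 0`,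
  `∑_{b ≠ x} I₁(K_{xb})/I₀(K_{xb}) ≤ A₀` for all `x` (`K_{xb} = J(x,b) + J(b,x)`), `d` `1`-Lipschitz along bonds
  with `d c = 0` ⇒ `⟨cos(θ_a − θ_c)⟩_J ≤ A₀^{d a}`.
* `twoPoint_layered_le_pow_besselRatio` — **the layered XY model on `ℤ³`** (in-plane `J∥`, inter-layer `J⊥`,
  inverse temperature `β`, free boundary conditions on any finite `Λ`):
  `⟨cos(θ_a − θ_c)⟩_Λ ≤ (4u(βJ∥) + 2u(βJ⊥))^{|a − c|₁}`, `u = I₁/I₀`. Exponential decay, uniformly in `Λ`, as soon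
  as `4u(βJ∥) + 2u(βJ⊥) < 1`: **`k_B T_c^{XY}(J∥, J⊥) ≤ T_L`, `4u(J∥/T_L) + 2u(J⊥/T_L) = 1`** — Lieb's improvement
  (`u(x) < x/2`, `besselRatio_le_half`) of the mean-field value `2J∥ + J⊥` (`twoPoint_layered_le_pow`);
  `J⊥ = 0`: `β_c ≥ u⁻¹(1/4)` (Lieb: `β_c ≥ 0.52`).
* `besselRatio_le` — Amos' kernel bound `u(x) ≤ x/√(x² + 4)` (`x > 0`, tree `BesselIRatioBounds`), whence the
  explicit corollary `twoPoint_layered_le_pow_amos` (`J⊥ = 0`: decay for `β < 2/√15 ≈ 0.516`).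

Cell use (`pub/hubbard-tc`, ASSUMPTIONS §1 key K5, lit THEOREMS-tc T6 "K5-Lieb column"): with `J∥ = ρ̄_s/2` and
`J⊥ = J̄⊥` under the modelling key K5 this is the kernel form of Lieb's ceiling on `T_c` of the effective classical
layered XY model — never a certified material statement. Not here: infinite volume / a `T_c` object.
-/

noncomputable section

open MeasureTheory Filter Finset
open scoped Topology BigOperators

namespace Literature.Probability.LatticeModels

namespace PlaneRotator

/-! ### Lieb's criterion with the Bessel ratio; the layered XY model -/

section Criterion

open Literature.Barriers.CriticalPhenomena Literature.Barriers.CriticalPhenomena.LongRangeIsing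

variable {V : Type} [Fintype V] [DecidableEq V] [MeasurableSpace Circle] [BorelSpace Circle]

/-- **Lieb's decay criterion with the two-spin values** (Theorem 4, finite volume, unconditional): for `J ≥ 0`, if
for every `x` the Bessel-ratio row sum `∑_{b ≠ x} I₁(K_{xb})/I₀(K_{xb}) ≤ A₀` (`K_{xb} = J(x,b) + J(b,x)`), and
`d` vanishes at `c` and is `1`-Lipschitz along the coupled pairs, then `⟨cos(θ_a − θ_c)⟩_J ≤ A₀^{d a}` — exponential
decay, with the same rate in every volume, as soon as `A₀ < 1`. [cite: Lieb1980, Theorem 4 (with eq. (23) for the star graph)] -/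
theorem twoPoint_le_pow_of_besselRatio_rowSum_le {J : V × V → ℝ} (hJ : ∀ p, 0 ≤ J p) {A₀ : ℝ}
    (hrow : ∀ x, ∑ b ∈ Finset.univ.erase x,
      besselI 1 (J (x, b) + J (b, x)) / besselI 0 (J (x, b) + J (b, x)) ≤ A₀)
    (c : V) {d : V → ℕ} (hd0 : d c = 0) (hd : ∀ x y, x ≠ y → (J (x, y) ≠ 0 ∨ J (y, x) ≠ 0) → d x ≤ d y + 1)
    (a : V) : twoPoint J a c ≤ A₀ ^ d a := by
  refine twoPoint_le_pow_of_star_rowSum_le liebRivasseauInequality_holds hJ (fun x => ?_) c hd0 hd a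
  refine le_of_eq_of_le (Finset.sum_congr rfl fun b hb => ?_) (hrow x)
  exact twoPoint_starCoupling_eq J (Finset.ne_of_mem_erase hb).symm

omit [Fintype V] [DecidableEq V] [MeasurableSpace Circle] [BorelSpace Circle] in
/-- A function vanishing at `0` passes through the layered coupling: `f(J_{x,y}) = J^{f}_{x,y}` with couplings
`f(J∥), f(J⊥)`. [folklore] -/
private theorem apply_layeredCoupling {f : ℝ → ℝ} (hf : f 0 = 0) (Jp Jz : ℝ) (x y : Site 3) :
    f (layeredCoupling Jp Jz x y) = layeredCoupling (f Jp) (f Jz) x y := by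
  unfold layeredCoupling
  split_ifs <;> first | rfl | exact hf

/-- **Lieb's bound for the layered XY model on `ℤ³`** (the `K5-Lieb` ceiling of the `pub/hubbard-tc` cell, XY side,
as a kernel theorem). For `β, J∥, J⊥ ≥ 0`, every finite `Λ ⊂ ℤ³` and `a, c ∈ Λ`:
`⟨cos(θ_a − θ_c)⟩_{Λ,β} ≤ (4·u(βJ∥) + 2·u(βJ⊥))^{|a − c|₁}`, `u(x) = I₁(x)/I₀(x)` the two-spin expectation. Hence
exponential decay uniformly in the volume for `T > T_L(J∥, J⊥)`, `4u(J∥/T_L) + 2u(J⊥/T_L) = 1`: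
`k_B T_c^{XY}(J∥, J⊥) ≤ T_L < 2J∥ + J⊥` in the finite-volume sense (`J⊥ = 0`: `β_c ≥ u⁻¹(1/4) ≈ 0.52`).
[cite: Lieb1980, Theorem 4 (β_c ≥ 0.52 for ν = 2, ≥ 0.34 for ν = 3)] -/
theorem twoPoint_layered_le_pow_besselRatio {β Jp Jz : ℝ} (hβ : 0 ≤ β) (hp : 0 ≤ Jp) (hz : 0 ≤ Jz)
    (Λ : Finset (Site 3)) (a c : Λ) :
    twoPoint (layeredXYCoupling β Jp Jz Λ) a c ≤
      (4 * (besselI 1 (β * Jp) / besselI 0 (β * Jp)) + 2 * (besselI 1 (β * Jz) / besselI 0 (β * Jz))) ^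
        l1Norm ((a : Site 3) - (c : Site 3)) := by
  classical
  set u : ℝ → ℝ := fun t => besselI 1 t / besselI 0 t with hu
  have hu0 : u 0 = 0 := by simp [hu, besselI_zero_right]
  have hu_nonneg : ∀ t, 0 ≤ t → 0 ≤ u t := fun t ht =>
    div_nonneg (besselI_nonneg ht 1) (besselI_nonneg ht 0)
  have hK : ∀ x y : Λ, layeredXYCoupling β Jp Jz Λ (x, y) + layeredXYCoupling β Jp Jz Λ (y, x) =
      layeredCoupling (β * Jp) (β * Jz) (x : Site 3) (y : Site 3) := by
    intro x y
    unfold layeredXYCoupling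
    rw [layeredCoupling_symm (y : Site 3) (x : Site 3),
      ← apply_layeredCoupling (f := fun t => β * t) (mul_zero β) Jp Jz]
    ring
  refine twoPoint_le_pow_of_besselRatio_rowSum_le (layeredXYCoupling_nonneg hβ hp hz Λ) (fun x => ?_) c
    (d := fun y : Λ => l1Norm ((y : Site 3) - (c : Site 3))) (by simp [l1Norm]) ?_ a
  · -- row sums: `u` passes through the layered coupling, then at most 4 + 2 neighbours
    have hrow : ∀ y : Λ, besselI 1 (layeredXYCoupling β Jp Jz Λ (x, y) + layeredXYCoupling β Jp Jz Λ (y, x)) /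
        besselI 0 (layeredXYCoupling β Jp Jz Λ (x, y) + layeredXYCoupling β Jp Jz Λ (y, x)) =
        layeredCoupling (u (β * Jp)) (u (β * Jz)) (x : Site 3) (y : Site 3) := by
      intro y
      rw [hK, ← apply_layeredCoupling hu0]
    simp_rw [hrow]
    calc ∑ y ∈ Finset.univ.erase x, layeredCoupling (u (β * Jp)) (u (β * Jz)) (x : Site 3) (y : Site 3)
        ≤ ∑ y : Λ, layeredCoupling (u (β * Jp)) (u (β * Jz)) (x : Site 3) (y : Site 3) :=
          Finset.sum_le_sum_of_subset_of_nonneg (Finset.erase_subset _ _) fun y _ _ =>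
            layeredCoupling_nonneg (hu_nonneg _ (mul_nonneg hβ hp)) (hu_nonneg _ (mul_nonneg hβ hz)) _ _
      _ ≤ 4 * u (β * Jp) + 2 * u (β * Jz) := by
          have h := sum_layeredCoupling_le (hu_nonneg _ (mul_nonneg hβ hp)) (hu_nonneg _ (mul_nonneg hβ hz)) Λ
            (x : Site 3)
          rwa [← Finset.sum_coe_sort Λ] at h
  · -- the `ℓ¹` distance to `c` is `1`-Lipschitz along nearest-neighbour bonds
    intro x y _ hxy
    have hne : layeredCoupling Jp Jz (x : Site 3) (y : Site 3) ≠ 0 := by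
      intro h0
      have h1 : layeredXYCoupling β Jp Jz Λ (x, y) = 0 := by
        unfold layeredXYCoupling; rw [h0, mul_zero]
      have h2 : layeredXYCoupling β Jp Jz Λ (y, x) = 0 := by
        unfold layeredXYCoupling; rw [layeredCoupling_symm (y : Site 3) (x : Site 3), h0, mul_zero]
      rcases hxy with h | h
      · exact h h1
      · exact h h2
    have h1 : l1Norm ((x : Site 3) - (y : Site 3)) = 1 := by
      unfold layeredCoupling at hne
      by_contra h
      exact hne (if_neg h)
    have htri : l1Norm ((x : Site 3) - (y : Site 3) + ((y : Site 3) - (c : Site 3))) ≤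
        l1Norm ((x : Site 3) - (y : Site 3)) + l1Norm ((y : Site 3) - (c : Site 3)) := by
      unfold l1Norm
      rw [← Finset.sum_add_distrib]
      exact Finset.sum_le_sum fun i _ => Int.natAbs_add_le _ _
    rw [sub_add_sub_cancel, h1] at htri
    simpa [add_comm] using htri

omit [Fintype V] [DecidableEq V] [MeasurableSpace Circle] [BorelSpace Circle] in
/-- **Amos' bound on the two-spin value**: `u(x) = I₁(x)/I₀(x) ≤ x/√(x² + 4)` for `x > 0` (tree
`besselI_succ_div_besselI_le_div`, `m = 0`); in particular `u(x) < x/2`, so Lieb's `T_L` improves the mean-field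
value. [cite: Amos1974, eq. (11) (m = 0)] -/
theorem besselRatio_le {x : ℝ} (hx : 0 < x) : besselI 1 x / besselI 0 x ≤ x / Real.sqrt (x ^ 2 + 4) := by
  have h := besselI_succ_div_besselI_le_div hx 0
  norm_num at h
  exact h

omit [Fintype V] [DecidableEq V] [MeasurableSpace Circle] [BorelSpace Circle] in
/-- The two-spin value is at most the mean-field value: `I₁(x)/I₀(x) ≤ x/2` for `x ≥ 0`. [cite: Amos1974, eq. (11) (m = 0)] -/
theorem besselRatio_le_half {x : ℝ} (hx : 0 ≤ x) : besselI 1 x / besselI 0 x ≤ x / 2 := by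
  rcases hx.eq_or_lt with h | h
  · rw [← h]
    simp [besselI_zero_right]
  · refine (besselRatio_le h).trans (div_le_div_of_nonneg_left h.le two_pos ?_)
    calc (2 : ℝ) = Real.sqrt 4 := by rw [show (4 : ℝ) = 2 ^ 2 by norm_num, Real.sqrt_sq two_pos.le]
      _ ≤ Real.sqrt (x ^ 2 + 4) := Real.sqrt_le_sqrt (by nlinarith)

/-- **Explicit form** of Lieb's layered bound with Amos' kernel inequality:
`⟨cos(θ_a − θ_c)⟩_Λ ≤ (4βJ∥/√((βJ∥)² + 4) + 2βJ⊥/√((βJ⊥)² + 4))^{|a − c|₁}` (`β, J∥, J⊥ ≥ 0`); for `J⊥ = 0` this gives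
decay for `β < 2/√15 ≈ 0.516`. [cite: Lieb1980, Theorem 4; Amos1974 eq. (11)] -/
theorem twoPoint_layered_le_pow_amos {β Jp Jz : ℝ} (hβ : 0 ≤ β) (hp : 0 ≤ Jp) (hz : 0 ≤ Jz)
    (Λ : Finset (Site 3)) (a c : Λ) :
    twoPoint (layeredXYCoupling β Jp Jz Λ) a c ≤
      (4 * (β * Jp / Real.sqrt ((β * Jp) ^ 2 + 4)) + 2 * (β * Jz / Real.sqrt ((β * Jz) ^ 2 + 4))) ^
        l1Norm ((a : Site 3) - (c : Site 3)) := by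
  refine (twoPoint_layered_le_pow_besselRatio hβ hp hz Λ a c).trans (pow_le_pow_left₀ ?_ ?_ _)
  · exact add_nonneg (mul_nonneg (by norm_num) (div_nonneg (besselI_nonneg (mul_nonneg hβ hp) 1)
      (besselI_nonneg (mul_nonneg hβ hp) 0)))
      (mul_nonneg (by norm_num) (div_nonneg (besselI_nonneg (mul_nonneg hβ hz) 1) (besselI_nonneg (mul_nonneg hβ hz) 0)))
  · have h1 : besselI 1 (β * Jp) / besselI 0 (β * Jp) ≤ β * Jp / Real.sqrt ((β * Jp) ^ 2 + 4) := by
      rcases (mul_nonneg hβ hp).eq_or_lt with h | h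
      · rw [← h]; simp [besselI_zero_right]
      · exact besselRatio_le h
    have h2 : besselI 1 (β * Jz) / besselI 0 (β * Jz) ≤ β * Jz / Real.sqrt ((β * Jz) ^ 2 + 4) := by
      rcases (mul_nonneg hβ hz).eq_or_lt with h | h
      · rw [← h]; simp [besselI_zero_right]
      · exact besselRatio_le h
    linarith

end Criterion

end PlaneRotator

end Literature.Probability.LatticeModels

end
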